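import Summits.AtomisticToContinuum.BoseEinsteinCondensation.Theorems.BECInsertionCorrectorCorrectorClosureFlatDomination
import Summits.AtomisticToContinuum.BoseEinsteinCondensation.Theorems.BECInsertionCorrectorCorrectorClosureFlatJensen
import Summits.AtomisticToContinuum.BoseEinsteinCondensation.Theorems.BECInsertionCorrectorCorrectorClosureFidelityLimit
import Summits.AtomisticToContinuum.BoseEinsteinCondensation.Theorems.BECInsertionCorrectorCorrectorClosureDoublingLeInvResidue
import Summits.AtomisticToContinuum.BoseEinsteinCondensation.Theorems.BECInsertionCorrectorCorrectorClosureUvTransfer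
import HarnessLib

/-!
# Ledger bridges for line `residue-area-law` of crux `BECInsertionCorrector.CorrectorClosure`
# (item stmt-AtomisticToContinuum-12058): uniform doubling bound ⟺ residue floor, and the healing bridge

Fixed `N`, `L > 0`, bounded periodised potential, continuous positive torus Feynman–Kac ground states
`Θ₀` (`N` bodies) and `Φ₀` (`N+1` bodies); `Z t = ∫_{cellN (N+1) L} ψ₀ · e^{-tH_{N+1}}ψ₀` the flat
insertion partition function (`ψ₀ = Θ₀ ∘ vecTail`, typed over `periodicFKSemigroup`), `D(t) =
Z(2t)Z(0)/Z(t)²` its doubling quotient and `A = L⁻³(∫Θ₀ ∫_cell Φ₀)²` the insertion residue of the true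
ground states. This file assembles the landed stubs of the line into the three bridges the lead's
skeleton v4 uses and documents:

* `residueFloor_of_uniformLedger`: `(∀ t ≥ 0, D(t) ≤ e^K) → e^{-K} ≤ A` (flat bounds + fidelity limit);
* `uniformLedger_of_residueFloor`: `e^{-K} ≤ A → ∀ t ≥ 0, D(t) ≤ e^K` (`doubling_le_inv_residue`,
  i.e. `D ≤ 1/A`) — so the line's heart (an `N`-uniform doubling bound) is EQUIVALENT to an `N`-uniform
  residue floor of the FK ground states;
* `residueFloor_of_kac` / `uniformLedger_of_kac`: the conclusion `cK·B ≤ A` of line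
  `healing-scale-kac-insertion`'s heart together with the landed `stub_uvTransfer` (`9/16 ≤ B`) gives
  the floor `9cK/16 ≤ A`, hence this line's heart — one heart serves both Feynman–Kac lines;
* `uniformLedger_shortTime`: the doubling bound on bounded time windows, `D(t) ≤ e^{2tκN/L³}`
  (`stub_flatDomination` + `stub_flatJensen`) — the open content of the heart is the limit `t → ∞`.
-/

noncomputable section

open MeasureTheory Filter Matrix
open scoped ENNReal NNReal BigOperators

namespace Summit.AtomisticToContinuum.BoseEinsteinCondensation.Theorems.CorrectorClosure.ResidueAreaLaw

open Literature.MathematicalPhysics.QuantumManyBody.BoseGas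
open Summit.AtomisticToContinuum.BoseEinsteinCondensation.Theorems.CorrectorClosure.HealingScaleKacInsertion
  (stub_uvTransfer)

/-- **The line's lever as a sufficient condition, at fixed `N`, `L`: a uniform doubling bound gives the
residue floor.** If `Θ₀`, `Φ₀` are the continuous positive FK ground states of `N` and `N+1` bodies in a
box `L > 0` with bounded `v^per` (bounded finite-range `v`), and the flat insertion partition function
obeys `𝒵(2t)·𝒵(0) ≤ e^K·𝒵(t)²` for all `t ≥ 0`, then `e^{-K} ≤ A = L⁻³(∫Θ₀∫_cell Φ₀)²`. Proof:
`𝒵 ∈ (0, ∞)` (`stub_flatDomination`, `stub_flatJensen`); for every `ε > 0` the fidelity limit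
(`stub_fidelityLimit`) gives a time with `𝒵(t)² ≤ (A + ε)𝒵(2t)𝒵(0) ≤ (A + ε)e^K𝒵(t)²`; cancel the
finite non-zero `𝒵(t)²` and let `ε → 0`. [folklore] -/
theorem residueFloor_of_uniformLedger (v : ℝ → ℝ≥0∞) (hv : IsRepulsiveFiniteRange v)
    (hbdd : ∃ C : ℝ≥0, ∀ r, v r ≤ C) (N : ℕ) (L : ℝ) (hL : 0 < L)
    (hb : ∃ C : ℝ≥0, ∀ x, periodizedPotential v L x ≤ C)
    (Θ₀ : Config N → ℝ) (hΘ : IsPeriodicGroundStateFK v L Θ₀) (hΘc : Continuous Θ₀)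
    (Φ₀ : Config (N + 1) → ℝ) (hΦ : IsPeriodicGroundStateFK v L Φ₀) (hΦc : Continuous Φ₀)
    (hΦp : ∀ X, 0 < Φ₀ X) (K : ℝ) (Z : ℝ → ℝ≥0∞)
    (hZ : Z = fun t => ∫⁻ X in cellN (N + 1) L, ENNReal.ofReal (Θ₀ (vecTail X)) *
      periodicFKSemigroup v L t (fun Y => ENNReal.ofReal (Θ₀ (vecTail Y))) X)
    (hD : ∀ t : ℝ, 0 ≤ t → Z (2 * t) * Z 0 ≤ ENNReal.ofReal (Real.exp K) * Z t ^ 2) :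
    ENNReal.ofReal (Real.exp (-K)) ≤
      ENNReal.ofReal ((L ^ 3)⁻¹ * (∫ X in cellN N L, Θ₀ X * ∫ x in cell L, Φ₀ (vecCons x X)) ^ 2) := by
  set A : ℝ≥0∞ := ENNReal.ofReal ((L ^ 3)⁻¹ *
      (∫ X in cellN N L, Θ₀ X * ∫ x in cell L, Φ₀ (vecCons x X)) ^ 2) with hA_def
  -- the flat bounds: `Z ∈ (0, ∞)`
  obtain ⟨-, hdom⟩ := stub_flatDomination v hv.1 N L hL Θ₀ hΘ Z hZ
  obtain ⟨κ, -, hJen⟩ := stub_flatJensen v hv hbdd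
  have hjen := hJen N L hL hb Θ₀ hΘ hΘc Z hZ
  have hfin : ∀ t : ℝ, 0 ≤ t → Z t ≠ 0 ∧ Z t ≠ ⊤ := by
    intro t ht
    refine ⟨fun h0 => ?_, ne_top_of_le_ne_top ENNReal.ofReal_ne_top (hdom t ht)⟩
    have h := hjen t ht
    rw [h0, nonpos_iff_eq_zero, ENNReal.ofReal_eq_zero] at h
    exact absurd h (not_le.mpr (by positivity))
  -- `e^{-K} ≤ A + ε` for every `ε > 0`
  refine ENNReal.le_of_forall_pos_le_add fun ε hε _ => ?_
  have hε' : (0 : ℝ) < (ε : ℝ) := NNReal.coe_pos.2 hε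
  obtain ⟨T₁, hframe⟩ := stub_fidelityLimit v hv.1 N L hL Θ₀ hΘ hΘc Φ₀ hΦ hΦc hΦp Z hZ (ε : ℝ) hε'
  set t : ℝ := max T₁ 0 with ht_def
  have ht0 : 0 ≤ t := le_max_right _ _
  have hεc : ENNReal.ofReal (ε : ℝ) = (ε : ℝ≥0∞) := ENNReal.ofReal_coe_nnreal
  have hA := hframe t (le_max_left _ _)
  rw [hεc] at hA
  have hB := hD t ht0
  have hsq0 : Z t ^ 2 ≠ 0 := pow_ne_zero _ (hfin t ht0).1
  have hsqt : Z t ^ 2 ≠ ⊤ := ENNReal.pow_ne_top (hfin t ht0).2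
  have hone : 1 * Z t ^ 2 ≤ (A + ε) * ENNReal.ofReal (Real.exp K) * Z t ^ 2 := by
    calc 1 * Z t ^ 2 = Z t ^ 2 := one_mul _
      _ ≤ (A + ε) * (Z (2 * t) * Z 0) := hA
      _ ≤ (A + ε) * (ENNReal.ofReal (Real.exp K) * Z t ^ 2) := mul_le_mul' le_rfl hB
      _ = (A + ε) * ENNReal.ofReal (Real.exp K) * Z t ^ 2 := by ring
  have hone' : (1 : ℝ≥0∞) ≤ (A + ε) * ENNReal.ofReal (Real.exp K) :=
    (ENNReal.mul_le_mul_iff_left hsq0 hsqt).mp hone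
  have hinv : ENNReal.ofReal (Real.exp (-K)) * ENNReal.ofReal (Real.exp K) = 1 := by
    rw [← ENNReal.ofReal_mul (Real.exp_pos _).le, ← Real.exp_add]
    simp
  calc ENNReal.ofReal (Real.exp (-K)) = ENNReal.ofReal (Real.exp (-K)) * 1 := (mul_one _).symm
    _ ≤ ENNReal.ofReal (Real.exp (-K)) * ((A + ε) * ENNReal.ofReal (Real.exp K)) :=
        mul_le_mul' le_rfl hone'
    _ = (A + ε) * (ENNReal.ofReal (Real.exp (-K)) * ENNReal.ofReal (Real.exp K)) := by ring
    _ = A + ε := by rw [hinv, mul_one]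

/-- **The converse, at fixed `N`, `L`: a residue floor gives the uniform ledger with `K = -log(floor)`
for EVERY `t ≥ 0`** (`D(t) ≤ 1/A`, the landed `doubling_le_inv_residue`: `‖e^{-tH/2}‖ = e^{-tE₀(N+1)/2}`
and positivity of `e^{-tH}` on `Φ₀^⊥`). Together with `residueFloor_of_uniformLedger` this makes the
heart `stub_uniformLedger` EQUIVALENT, given the landed frame, to an `N`-uniform residue floor of the
torus FK ground states. [folklore] -/
theorem uniformLedger_of_residueFloor (v : ℝ → ℝ≥0∞) (hv : Measurable v) (N : ℕ) (L : ℝ) (hL : 0 < L)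
    (hb : ∃ C : ℝ≥0, ∀ x, periodizedPotential v L x ≤ C)
    (Θ₀ : Config N → ℝ) (hΘ : IsPeriodicGroundStateFK v L Θ₀) (hΘc : Continuous Θ₀)
    (Φ₀ : Config (N + 1) → ℝ) (hΦ : IsPeriodicGroundStateFK v L Φ₀) (hΦc : Continuous Φ₀)
    (hΦp : ∀ X, 0 < Φ₀ X) (K : ℝ) (Z : ℝ → ℝ≥0∞)
    (hZ : Z = fun t => ∫⁻ X in cellN (N + 1) L, ENNReal.ofReal (Θ₀ (vecTail X)) *
      periodicFKSemigroup v L t (fun Y => ENNReal.ofReal (Θ₀ (vecTail Y))) X)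
    (hfloor : ENNReal.ofReal (Real.exp (-K)) ≤
      ENNReal.ofReal ((L ^ 3)⁻¹ * (∫ X in cellN N L, Θ₀ X * ∫ x in cell L, Φ₀ (vecCons x X)) ^ 2))
    (t : ℝ) (ht : 0 ≤ t) :
    Z (2 * t) * Z 0 ≤ ENNReal.ofReal (Real.exp K) * Z t ^ 2 := by
  have h := doubling_le_inv_residue v hv N L hL hb Θ₀ hΘ hΘc Φ₀ hΦ hΦc hΦp Z hZ t ht
  have hone : ENNReal.ofReal (Real.exp K) * ENNReal.ofReal (Real.exp (-K)) = 1 := by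
    rw [← ENNReal.ofReal_mul (Real.exp_pos _).le, ← Real.exp_add]
    simp
  calc Z (2 * t) * Z 0
      = ENNReal.ofReal (Real.exp K) * (ENNReal.ofReal (Real.exp (-K)) * (Z (2 * t) * Z 0)) := by
        rw [← mul_assoc, hone, one_mul]
    _ ≤ ENNReal.ofReal (Real.exp K) *
          (ENNReal.ofReal ((L ^ 3)⁻¹ *
              (∫ X in cellN N L, Θ₀ X * ∫ x in cell L, Φ₀ (vecCons x X)) ^ 2) *
            (Z (2 * t) * Z 0)) := mul_le_mul' le_rfl (mul_le_mul' hfloor le_rfl)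
    _ ≤ ENNReal.ofReal (Real.exp K) * Z t ^ 2 := mul_le_mul' le_rfl h

/-- **One heart serves both FK lines.** At fixed `N`, `L` (bounded `v^per`, continuous positive FK
ground states, `Θ₀ = periodicFKGroundState v N L`, `Φ₀ = periodicFKGroundState v (N+1) L`): the
conclusion `cK · B ≤ A` of line `healing-scale-kac-insertion`'s registered heart `stub_kacClosure`
(`B` = the mass of the tagged-coordinate mollification of `Φ₀` at the healing time, here an arbitrary
`B` with the landed `stub_uvTransfer` bound `9/16 ≤ B`) gives the residue floor `9cK/16 ≤ A`, hence
(`uniformLedger_of_residueFloor`) this line's heart with `K = log(16/(9cK))`. So a proof of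
`stub_kacClosure` closes `stub_uniformLedger` as well (the converse is not claimed). [folklore] -/
theorem residueFloor_of_kac {cK : ℝ} (hcK : 0 < cK) {A B : ℝ≥0∞}
    (hUV : ENNReal.ofReal (9 / 16) ≤ B) (hKac : ENNReal.ofReal cK * B ≤ A) :
    ENNReal.ofReal (Real.exp (-Real.log (16 / (9 * cK)))) ≤ A := by
  have h : Real.exp (-Real.log (16 / (9 * cK))) = cK * (9 / 16) := by
    rw [Real.exp_neg, Real.exp_log (by positivity)]
    field_simp
  rw [h, ENNReal.ofReal_mul hcK.le]
  exact (mul_le_mul' le_rfl hUV).trans hKac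

/-- The instance of `residueFloor_of_kac` with the landed `stub_uvTransfer` supplying `9/16 ≤ B` for the
canonical `(N+1)`-body FK ground state: healing's heart inequality at `(N, L)` ⇒ this line's uniform
ledger at `(N, L)` with `K = log(16/(9cK))`, for every `t ≥ 0`. [folklore] -/
theorem uniformLedger_of_kac (v : ℝ → ℝ≥0∞) (hv : Measurable v) (N : ℕ) (L : ℝ) (hL : 0 < L)
    (hb : ∃ C : ℝ≥0, ∀ x, periodizedPotential v L x ≤ C)
    (hΘ : IsPeriodicGroundStateFK v L (periodicFKGroundState v N L))
    (hΘc : Continuous (periodicFKGroundState v N L))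
    (hΦ : IsPeriodicGroundStateFK v L (periodicFKGroundState v (N + 1) L))
    (hΦc : Continuous (periodicFKGroundState v (N + 1) L))
    (hΦp : ∀ X, 0 < periodicFKGroundState v (N + 1) L X) {cK : ℝ} (hcK : 0 < cK)
    (hKac : ENNReal.ofReal cK *
        ∫⁻ X in cellN (N + 1) L, ENNReal.ofReal
          ((let T : ℝ := ((N : ℝ) + 1) / (16 * (periodicGroundStateEnergy v (N + 1) L).toReal)
            if T ≤ 0 then periodicFKGroundState v (N + 1) L X
            else ∫ z : Space, ((4 * Real.pi * T) ^ (3 / 2 : ℝ))⁻¹ * Real.exp (-‖z‖ ^ 2 / (4 * T)) *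
              periodicFKGroundState v (N + 1) L (vecCons (X 0 - z) (vecTail X))) ^ 2) ≤
      ENNReal.ofReal ((L ^ 3)⁻¹ *
        (∫ X in cellN N L, periodicFKGroundState v N L X *
          ∫ x in cell L, periodicFKGroundState v (N + 1) L (vecCons x X)) ^ 2))
    (Z : ℝ → ℝ≥0∞)
    (hZ : Z = fun t => ∫⁻ X in cellN (N + 1) L, ENNReal.ofReal (periodicFKGroundState v N L (vecTail X)) *
      periodicFKSemigroup v L t (fun Y => ENNReal.ofReal (periodicFKGroundState v N L (vecTail Y))) X)
    (t : ℝ) (ht : 0 ≤ t) :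
    Z (2 * t) * Z 0 ≤ ENNReal.ofReal (Real.exp (Real.log (16 / (9 * cK)))) * Z t ^ 2 :=
  uniformLedger_of_residueFloor v hv N L hL hb _ hΘ hΘc _ hΦ hΦc hΦp _ Z hZ
    (residueFloor_of_kac hcK (stub_uvTransfer v hv N L hL hΦ) hKac) t ht

/-- **Short times are settled (what is NOT open in the heart).** From the two landed flat bounds,
`𝒵(2t) ≤ L³e^{-2tE₀(N)}`, `𝒵(0) = L³` (`stub_flatDomination`) and `𝒵(t) ≥ L³e^{-t(E₀(N)+κN/L³)}`
(`stub_flatJensen`, `κ = ∫v`): `𝒵(2t)·𝒵(0) ≤ e^{2tκN/L³}·𝒵(t)²` for EVERY `t ≥ 0`, every box and every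
`N` — i.e. the uniform ledger `stub_uniformLedger` holds on any bounded time window `[0, T]` with
`K = 2κρT` in the crux's boxes (`N/L³ ≤ ρ`); its open content is the limit `T → ∞` (the infrared tail).
[folklore] -/
theorem uniformLedger_shortTime (v : ℝ → ℝ≥0∞) (hv : IsRepulsiveFiniteRange v)
    (hbdd : ∃ C : ℝ≥0, ∀ r, v r ≤ C) :
    ∃ κ : ℝ, 0 ≤ κ ∧ ∀ (N : ℕ) (L : ℝ), 0 < L →
      (∃ C : ℝ≥0, ∀ x, periodizedPotential v L x ≤ C) →
      ∀ (Θ₀ : Config N → ℝ), IsPeriodicGroundStateFK v L Θ₀ → Continuous Θ₀ →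
      ∀ (Z : ℝ → ℝ≥0∞),
        (Z = fun t => ∫⁻ X in cellN (N + 1) L, ENNReal.ofReal (Θ₀ (vecTail X)) *
          periodicFKSemigroup v L t (fun Y => ENNReal.ofReal (Θ₀ (vecTail Y))) X) →
      ∀ t : ℝ, 0 ≤ t →
        Z (2 * t) * Z 0 ≤ ENNReal.ofReal (Real.exp (2 * κ * N / L ^ 3 * t)) * Z t ^ 2 := by
  obtain ⟨κ, hκ, hJen⟩ := stub_flatJensen v hv hbdd
  refine ⟨κ, hκ, fun N L hL hb Θ₀ hΘ hΘc Z hZ t ht => ?_⟩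
  obtain ⟨hZ0, hdom⟩ := stub_flatDomination v hv.1 N L hL Θ₀ hΘ Z hZ
  have h1 := hJen N L hL hb Θ₀ hΘ hΘc Z hZ t ht
  have h2 := hdom (2 * t) (by positivity)
  set E : ℝ := (periodicGroundStateEnergy v N L).toReal with hE
  have hL3 : 0 < L ^ 3 := by positivity
  -- `L³e^{-2tE} · L³ = e^{2κNt/L³} · (L³ e^{-(E+κN/L³)t})²`
  have hexp : L ^ 3 * Real.exp (-(E * (2 * t))) * L ^ 3 =
      Real.exp (2 * κ * N / L ^ 3 * t) * (L ^ 3 * Real.exp (-((E + κ * N / L ^ 3) * t))) ^ 2 := by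
    have : Real.exp (-(E * (2 * t))) = Real.exp (2 * κ * N / L ^ 3 * t) *
        (Real.exp (-((E + κ * N / L ^ 3) * t)) * Real.exp (-((E + κ * N / L ^ 3) * t))) := by
      rw [← Real.exp_add, ← Real.exp_add]
      congr 1; ring
    rw [this]; ring
  calc Z (2 * t) * Z 0
      ≤ ENNReal.ofReal (L ^ 3 * Real.exp (-(E * (2 * t)))) * ENNReal.ofReal (L ^ 3) := by
        rw [hZ0]; exact mul_le_mul' h2 le_rfl
    _ = ENNReal.ofReal (Real.exp (2 * κ * N / L ^ 3 * t) *
          (L ^ 3 * Real.exp (-((E + κ * N / L ^ 3) * t))) ^ 2) := by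
        rw [← ENNReal.ofReal_mul (by positivity), hexp]
    _ = ENNReal.ofReal (Real.exp (2 * κ * N / L ^ 3 * t)) *
          ENNReal.ofReal (L ^ 3 * Real.exp (-((E + κ * N / L ^ 3) * t))) ^ 2 := by
        rw [ENNReal.ofReal_mul (Real.exp_pos _).le, ENNReal.ofReal_pow (by positivity)]
    _ ≤ ENNReal.ofReal (Real.exp (2 * κ * N / L ^ 3 * t)) * Z t ^ 2 :=
        mul_le_mul' le_rfl (pow_le_pow_left' h1 2)

end Summit.AtomisticToContinuum.BoseEinsteinCondensation.Theorems.CorrectorClosure.ResidueAreaLaw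

end
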